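import Summits.ABC.StewartYu.ArchG3ScheduleQ
import Summits.ABC.StewartYu.ArchG3StepPacksD
import HarnessLib

/-!
# Cell abc-stewartyu, rung A1.L (crux r2 `ArchCoreRat`), WP-L.A: the level schedule over the GENERIC-DENOMINATOR packages with the
# virtual-box predicates `V lev` and the family invariant `Q` (ruling R34 / R34-implementation, vehicle file 4; R32 (c1))

`Summits/ABC/StewartYu/ArchG3ScheduleD.lean` — cell `abc-stewartyu` (HOME `run/shared/lean/pub/abc-stewartyu/`; seat lp-1 g8).  One definition
(`ArchHalfStepHypD`) and theorems on `ArchG3Setup`; no named fact, no numerics.  Sequel of `ArchG3Schedule` / `ArchG3ScheduleQ` /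
`ArchG3StepPacksD`: the SAME induction over the levels, where
* the states are `ArchLevelStateQ Q …` (family-level invariant `Q B v lev`, e.g. the virtual INTERVAL box of `ν ∘ v`, R32 (c1));
* the record packages are the generic ones — `ArchKStepHypD … (V lev) …`, `ArchKStepOddHypD … (V lev) …`, `ArchHalfStepHypD … (V lev) …` —
  whose clearing / size obligations are asked only for exponent vectors with `V lev w′` (pointwise, e.g. `|ν(w′)ⱼ| ≤ Bv lev j`);
* ONE link hypothesis `hQV : ∀ lev B v, Q B v lev → ∀ i ∈ B, V lev (v i)` feeds the family invariant to the packages, and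
  `hQhalf` moves `Q` across the half-step (`(B, v) ↦ (parityClass v B i₀, halfDiff v i₀)`).
`ArchLvInv.halfStep_of_hypD`, `levelZeroRunD`, `levelUpD`, `levelsD`, **`lastLevelState_of_scheduleD`** (⇒ `ArchLevelStateQ Q … Ŝ (N Ŝ n) (T Ŝ n)`;
then `lastLevelInv_feldR` / `frameOutput_of_scheduleQ` of `ArchG3ScheduleQ` apply verbatim).  `V = ⊤`, `Q = ⊤`, `Dm = monDen` is the
`N = 1` schedule of `ArchG3Schedule`.

WHAT THIS IS NOT: no change to the ✓ schedule files; no choice of `Q`, `V`, `Dm`, `Dh`; no crux moves.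

References: Yu. V. Nesterenko, LNM 1819 (2003) §4 Prop. 4.1, §4.2–4.3 (4.24)–(4.51), §3.5 (3.41)–(3.44), p. 76–78, 80–95 [Nesterenko2003];
K. Yu, Acta Math. 211 (2013) Lemma 5.2, §5.1 [Yu2013].
-/

noncomputable section

open Finset Polynomial
open Literature.NumberTheory.Transcendental
open Literature.NumberTheory.Transcendental.CW77 (heightProd)
open Literature.NumberTheory.Transcendental.CW77.Setup (Tau tauNorm)
open Summit.ABC.StewartYu.ArchSupply (scaledFeldR)
open scoped Nat

namespace Summit.ABC.StewartYu

namespace ArchG3Setup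

variable (S : ArchG3Setup) {ι : Type*}

/-! ### The record package of one half-step, generic form -/

/-- **Record package of one Kummer half-step, generic denominators / virtual box** (`(s, n) → (s+1, 0)`): the text of `ArchHalfStepHypU`
with the termwise integrality `hint` and size `hMt` asked only for exponent vectors `w′` in the box WITH `V w′` AND in the slab
`|Lsum w′| ≤ γb + w` (R34-implementation (α)/(β): virtual denominators `Dh`, slab-based sizes `Mt`). [cite: Nesterenko2003, §4.3 (4.36)–(4.51),
p. 90–95; shape only] -/
def ArchHalfStepHypD (R R' : ι → ℚ[X]) (U : Finset ι) (L : Fin S.n → ℕ) (P : ℤ) (w γb : ℝ) (c : ℤ) (e : Fin S.n → ℤ) (c' : ℤ)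
    (δ₀ : ℝ) (V : (Fin S.n → ℤ) → Prop) (N N₁ T T' : ℕ) : Prop :=
  ∃ (t : ℕ) (ca : ℕ → ℚ) (A Γ : Fin S.n → ℝ) (DΔ E Wd Wn Wh C Mt : ℝ) (Dh : ℕ → ℤ → ℕ),
    1 ≤ t ∧ T' + t ≤ T ∧ 2 * N₁ ≤ 6 * N + 5 ∧ (∀ a, ca a ≠ 0) ∧
    (∀ i ∈ U, ∀ (a : ℕ) (s : ℤ), (hasseDeriv a (R i)).eval ((s : ℚ) / 2) = ca a * (hasseDeriv a (R' i)).eval (s : ℚ)) ∧ c' ≠ 0 ∧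
    (∀ k, |S.lg k| ≤ A k) ∧ (∀ k, 0 ≤ Γ k) ∧
    (∀ w' : Fin S.n → ℤ, (∀ j, |w' j| ≤ (L j : ℤ)) → ∀ k, |(S.zγ w' k : ℝ)| ≤ Γ k) ∧
    0 ≤ DΔ ∧
    (∀ w' : Fin S.n → ℤ, (∀ j, |w' j| ≤ (L j : ℤ)) → ∀ (a : ℕ) (μ : Fin S.n → ℕ), a + ∑ k, μ k < T' →
      |((∏ k, Ring.multichoose (S.yΔ c e w' k) (μ k) : ℤ) : ℝ)| ≤ DΔ) ∧
    1 ≤ E ∧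
    (∀ i ∈ U, ∀ a < T', ∀ z : ℂ, ‖z‖ ≤ (3 * E + 1) * (2 * N + 1) + N → ‖(hw R i a).eval z‖ ≤ Wd) ∧
    0 ≤ Wn ∧ (∀ i ∈ U, ∀ t₀ < T, ∀ x : ℤ, |x| ≤ (N : ℤ) → |(((hasseDeriv t₀ (R i)).eval (x : ℚ) : ℚ) : ℝ)| ≤ Wn) ∧
    0 ≤ Wh ∧ (∀ i ∈ U, ∀ a < T', ∀ s : ℤ, Odd s → |s| ≤ 2 * (N₁ : ℤ) - 1 → ‖(hw R i a).eval ((s : ℂ) / 2)‖ ≤ Wh) ∧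
    0 ≤ w ∧ (L S.j₀ : ℝ) * δ₀ * (3 * N + 2) ≤ 1 ∧ 1 ≤ C ∧
    (∀ a s, 1 ≤ Dh a s) ∧
    (∀ a < T', ∀ s : ℤ, Odd s → |s| ≤ 2 * (N₁ : ℤ) - 1 → ∀ i ∈ U, ∀ w' : Fin S.n → ℤ, (∀ j, |w' j| ≤ (L j : ℤ)) → V w' →
      |S.Lsum w'| ≤ γb + w → ∃ z : ℤ, (Dh a s : ℚ) * ((hasseDeriv a (R i)).eval ((s : ℚ) / 2) * S.qEhZ w' s) = z) ∧
    0 ≤ Mt ∧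
    (∀ a < T', ∀ s : ℤ, Odd s → |s| ≤ 2 * (N₁ : ℤ) - 1 → ∀ i ∈ U, ∀ w' : Fin S.n → ℤ, (∀ j, |w' j| ≤ (L j : ℤ)) → V w' →
      |S.Lsum w'| ≤ γb + w → |(((hasseDeriv a (R i)).eval ((s : ℚ) / 2) * S.qEhZ w' s : ℚ) : ℝ)| ≤ Mt) ∧
    (∀ s : ℤ, Odd s → |s| ≤ 2 * (N₁ : ℤ) - 1 → ∀ (a : ℕ) (μ : Fin S.n → ℕ), a + ∑ k, μ k < T' →
      Real.exp (γb * (3 * N + 2)) *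
          (2 * ((2 * N + 1 : ℕ) : ℝ) ^ (t + 1) * t * (20 * Real.exp 1) ^ ((2 * N + 1) * t) *
              ((2 * C) ^ t * Real.exp (γb * (N + 1)) *
                ((2 : ℝ) ^ a * Real.exp ((∑ k, A k * Γ k) / C) *
                  (U.card * (P * DΔ) * Wn * Real.exp ((γb + w) * N) * (2 * ((L S.j₀ : ℝ) * δ₀ * N))))) +
            U.card * (P * DΔ) * Wd * Real.exp ((w + (L S.j₀ : ℝ) * δ₀) * ((3 * E + 1) * (2 * N + 1) + N)) * (1 / E) ^ ((2 * N + 1) * t)) +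
        U.card * (P * DΔ) * Wh * Real.exp ((γb + w) * (3 * N + 2)) * (2 * ((L S.j₀ : ℝ) * δ₀ * (3 * N + 2))) <
      (1 + U.card * (P * DΔ) * Mt) / (4 * (Dh a s : ℝ) * (1 + U.card * (P * DΔ) * Mt) * heightProd S.α ^ 2) ^ (2 ^ S.n))

namespace ArchLvInv

variable {S} {R R' : ι → ℚ[X]} {U B : Finset ι} {v : ι → Fin S.n → ℤ} {pv : ι → ℤ} {lo : Fin S.n → ℤ} {L : Fin S.n → ℕ} {P : ℤ}
  {w γ γb : ℝ} {c c' : ℤ} {e e' : Fin S.n → ℤ} {δ₀ : ℝ} {N N₁ T T' : ℕ}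

/-- **The half-step from the generic package** (`B ⊆ U`, independent square classes, `|Λ/b_{j₀}| ≤ δ₀`, `V` on the family): the
termwise integrality / sizes are instantiated at `w′ = vᵢ`, which lies in the box, satisfies `V` (hypothesis `hV`) and the slab
`|Lsum vᵢ| ≤ |γ| + w ≤ γb + w`. [cite: Nesterenko2003, §4.3 (4.36)–(4.51), Lemma 4.4, p. 90–95] -/
theorem halfStep_of_hypD {V : (Fin S.n → ℤ) → Prop} (hBU : B ⊆ U) (h : S.ArchLvInv R B v pv lo L P w γ c e {x : ℤ | |x| ≤ (N : ℤ)} T)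
    (hind : ∀ T₁ : Finset (Fin S.n), T₁.Nonempty → ¬ IsSquare (∏ j ∈ T₁, S.α j))
    (hΛ : |S.Λ / (S.b S.j₀ : ℝ)| ≤ δ₀) (hγ : |γ| ≤ γb) (hV : ∀ i ∈ B, V (v i))
    (H : S.ArchHalfStepHypD R R' U L P w γb c e c' δ₀ V N N₁ T T') (e' : Fin S.n → ℤ) :
    ∃ i₀ ∈ B, pv i₀ ≠ 0 ∧
      S.ArchLvInv R' (S.parityClass v B i₀) (S.halfDiff v i₀) pv (fun j => -((v i₀ j - lo j) / 2)) (fun j => L j / 2) P (w / 2)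
        ((γ - S.Lsum (v i₀)) / 2) c' e' {x : ℤ | Odd x ∧ |x| ≤ 2 * (N₁ : ℤ) - 1} T' := by
  obtain ⟨t, ca, A, Γ, DΔ, E, Wd, Wn, Wh, C, Mt, Dh, ht, hT, hN₁, hca, hRR', hc', hA, hΓ0, hΓ, hDΔ0, hDΔ, hE, hWd, hWn0, hWn,
    hWh0, hWh, hw0, hsmall, hC, hDh, hint, hMt0, hMt, hfinal⟩ := H
  obtain ⟨i₁, hi₁B, _⟩ := h.nonzero
  have hBc : (B.card : ℝ) ≤ U.card := by exact_mod_cast card_le_card hBU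
  have hP0 := h.P_nonneg
  have hslab : ∀ i ∈ B, |S.Lsum (v i)| ≤ γb + w := fun i hi => (h.abs_Lsum_le i hi).trans (by linarith)
  have hPΔ : ∀ (a : ℕ) (μ : Fin S.n → ℕ), a + ∑ k, μ k < T' → ∀ i ∈ B, |(S.pvΔ v pv c e μ i : ℝ)| ≤ P * DΔ :=
    fun a μ haμ => h.abs_pvΔ_le_of_box fun w' hw' => hDΔ w' hw' a μ haμ
  -- the term `rHalf` at `τ = (a, 0)` is `(Hasse_a Rᵢ)(s/2) · qEhZ(vᵢ) s`
  have hrHalf : ∀ (i : ι) (a : ℕ) (s : ℤ), S.rHalf R v i ((a, 0) : Tau S.n) s =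
      (hasseDeriv a (R i)).eval ((s : ℚ) / 2) * S.qEhZ (v i) s := by
    intro i a s; simp [ArchG3Setup.rHalf]
  refine h.halfStep hind ht hT hN₁ ca hca (fun i hi => hRR' i (hBU hi)) hc' e' hBc hA hΓ0
    (fun i hi k => hΓ (v i) (h.abs_le i hi) k) (mul_nonneg hP0 hDΔ0) hPΔ hE (fun i hi => hWd i (hBU hi)) hWn0 (fun i hi => hWn i (hBU hi))
    hWh0 (fun i hi => hWh i (hBU hi)) hw0 hΛ hsmall hC (fun s a _μ => Dh a s) (fun s a _μ => hDh a s) ?_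
    (fun s a _μ => 1 + U.card * (P * DΔ) * Mt) (fun s a _μ => ?_) ?_ ?_
  · -- denominators of the class sums from the termwise integrality
    intro s hso hs a μ haμ T₁
    refine S.exists_int_mul_halfClassVec R v B _ _ s (fun i hi => ?_) T₁
    rw [hrHalf]
    exact hint a (by omega) s hso hs i (hBU hi) (v i) (h.abs_le i hi) (hV i hi) (hslab i hi)
  · -- `1 ≤ Mb`
    have : 0 ≤ (U.card : ℝ) * (P * DΔ) * Mt := by positivity
    linarith
  · -- total size of the class sums from the termwise bound
    intro s hso hs a μ haμ
    have h1 := S.sum_abs_halfClassVec_le_of_forall R v B (S.pvΔ v pv c e μ) ((a, 0) : Tau S.n) s (hPΔ a μ haμ)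
      (fun i hi => by rw [hrHalf]; exact hMt a (by omega) s hso hs i (hBU hi) (v i) (h.abs_le i hi) (hV i hi) (hslab i hi))
    have h2 : (B.card : ℝ) * (P * DΔ) * Mt ≤ U.card * (P * DΔ) * Mt :=
      mul_le_mul_of_nonneg_right (mul_le_mul_of_nonneg_right hBc (mul_nonneg hP0 hDΔ0)) hMt0
    linarith
  · -- the inequality: the actual `|γ|` is majorised by `γb`
    intro s hso hs a μ haμ
    refine lt_of_le_of_lt ?_ (hfinal s hso hs a μ haμ)
    have hγ0 : 0 ≤ |γ| := abs_nonneg _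
    have hWd0 : 0 ≤ Wd := le_trans (norm_nonneg _) (hWd i₁ (hBU hi₁B) a (by omega) 0 (by simp; positivity))
    have hU0 : (0 : ℝ) ≤ U.card := Nat.cast_nonneg _
    have hPD : 0 ≤ (P : ℝ) * DΔ := mul_nonneg hP0 hDΔ0
    have hδ₀ : 0 ≤ δ₀ := (abs_nonneg _).trans hΛ
    have hC0 : 0 < C := by linarith
    set PD : ℝ := (P : ℝ) * DΔ with hPDdef
    gcongr

end ArchLvInv

/-! ### The schedule over the generic packages -/

variable {S}

/-- **The k-steps of level `0` over the generic packages** (`(B, v)` unchanged; `V 0` fed from `Q` by `hQV`). [cite: Nesterenko2003, §4.2 (the sets 𝒳_{0,ν}), p. 87–88] -/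
theorem levelZeroRunD {Q : Finset (ℕ × (Fin S.n → ℤ)) → ((ℕ × (Fin S.n → ℤ)) → Fin S.n → ℤ) → ℕ → Prop} {V : ℕ → (Fin S.n → ℤ) → Prop}
    {H Sh : ℕ} {s : Fin S.n → ℕ} {U : Finset (ℕ × (Fin S.n → ℤ))} {pv : ℕ × (Fin S.n → ℤ) → ℤ} {P : ℤ} {δ₀ : ℝ}
    {wl γb : ℕ → ℝ} {cl : ℕ → ℤ} {el : ℕ → Fin S.n → ℤ} (hΛ : |S.Λ / (S.b S.j₀ : ℝ)| ≤ δ₀)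
    (hQV : ∀ lev B v, Q B v lev → ∀ i ∈ B, V lev (v i)) (N T : ℕ → ℕ → ℕ)
    (hK0 : ∀ ν, ν < S.n → S.ArchKStepHypD (fun i => scaledFeldR i.1 H (Sh - 0)) U (S.Lb s 0) P (wl 0) (γb 0) (cl 0) (el 0) δ₀ (V 0)
      (N 0 ν) (N 0 (ν + 1)) (T 0 ν) (T 0 (ν + 1)))
    (h00 : S.ArchLevelStateQ Q H Sh s U pv P wl γb cl el 0 (N 0 0) (T 0 0)) :
    S.ArchLevelStateQ Q H Sh s U pv P wl γb cl el 0 (N 0 S.n) (T 0 S.n) := by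
  obtain ⟨B, v, lo, γ, hBU, hinj, hγ, h, hQ⟩ := h00
  have h1 := ArchLvInv.kchainD hBU hΛ hγ (hQV 0 B v hQ) (N 0) (T 0) 0 S.n (fun ν _ h1 => hK0 ν (by omega)) (by simpa using h)
  exact ⟨B, v, lo, γ, hBU, hinj, hγ, by simpa using h1, hQ⟩

/-- **One level up over the generic packages** (`V lev` / `V (lev+1)` fed from `Q` by `hQV`): half-step (`(B, v) ↦ (parityClass v B i₀, halfDiff v i₀)`, so `Q` moves by `hQhalf`) + odd-node k-step +
`n − 1` k-steps (`(B, v)` unchanged). [cite: Nesterenko2003, §4 Prop. 4.1, §4.2–4.3, p. 80–95] -/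
theorem levelUpD {Q : Finset (ℕ × (Fin S.n → ℤ)) → ((ℕ × (Fin S.n → ℤ)) → Fin S.n → ℤ) → ℕ → Prop} {V : ℕ → (Fin S.n → ℤ) → Prop}
    {H Sh : ℕ} {s : Fin S.n → ℕ} {U : Finset (ℕ × (Fin S.n → ℤ))} {pv : ℕ × (Fin S.n → ℤ) → ℤ} {P : ℤ} {δ₀ : ℝ}
    {wl γb : ℕ → ℝ} {cl : ℕ → ℤ} {el : ℕ → Fin S.n → ℤ} (hn : 1 ≤ S.n)
    (hind : ∀ T₁ : Finset (Fin S.n), T₁.Nonempty → ¬ IsSquare (∏ j ∈ T₁, S.α j)) (hΛ : |S.Λ / (S.b S.j₀ : ℝ)| ≤ δ₀)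
    (hQhalf : ∀ (lev : ℕ) (B : Finset (ℕ × (Fin S.n → ℤ))) (v : ℕ × (Fin S.n → ℤ) → Fin S.n → ℤ) (i₀ : ℕ × (Fin S.n → ℤ)),
      i₀ ∈ B → Q B v lev → Q (S.parityClass v B i₀) (S.halfDiff v i₀) (lev + 1))
    (hQV : ∀ lev B v, Q B v lev → ∀ i ∈ B, V lev (v i)) (N T : ℕ → ℕ → ℕ) (Nh : ℕ → ℕ) (lev : ℕ) (hwl : wl (lev + 1) = wl lev / 2) (hγb : wl lev / 2 ≤ γb (lev + 1))
    (hH : S.ArchHalfStepHypD (fun i => scaledFeldR i.1 H (Sh - lev)) (fun i => scaledFeldR i.1 H (Sh - (lev + 1))) U (S.Lb s lev) P (wl lev)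
      (γb lev) (cl lev) (el lev) (cl (lev + 1)) δ₀ (V lev) (N lev S.n) (Nh (lev + 1)) (T lev S.n) (T (lev + 1) 0))
    (hO : S.ArchKStepOddHypD (fun i => scaledFeldR i.1 H (Sh - (lev + 1))) U (S.Lb s (lev + 1)) P (wl (lev + 1)) (γb (lev + 1))
      (cl (lev + 1)) (el (lev + 1)) δ₀ (V (lev + 1)) (Nh (lev + 1)) (N (lev + 1) 1) (T (lev + 1) 0) (T (lev + 1) 1))
    (hK : ∀ ν, 1 ≤ ν → ν < S.n → S.ArchKStepHypD (fun i => scaledFeldR i.1 H (Sh - (lev + 1))) U (S.Lb s (lev + 1)) P (wl (lev + 1))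
      (γb (lev + 1)) (cl (lev + 1)) (el (lev + 1)) δ₀ (V (lev + 1)) (N (lev + 1) ν) (N (lev + 1) (ν + 1)) (T (lev + 1) ν) (T (lev + 1) (ν + 1)))
    (hst : S.ArchLevelStateQ Q H Sh s U pv P wl γb cl el lev (N lev S.n) (T lev S.n)) :
    S.ArchLevelStateQ Q H Sh s U pv P wl γb cl el (lev + 1) (N (lev + 1) S.n) (T (lev + 1) S.n) := by
  classical
  obtain ⟨B, v, lo, γ, hBU, hinj, hγ, h, hQ⟩ := hst
  obtain ⟨i₀, hi₀B, _, h1⟩ := ArchLvInv.halfStep_of_hypD hBU h hind hΛ hγ (hQV lev B v hQ) hH (el (lev + 1))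
  have hB'U : S.parityClass v B i₀ ⊆ U := (S.parityClass_subset v B i₀).trans hBU
  have hγ' : |(γ - S.Lsum (v i₀)) / 2| ≤ γb (lev + 1) := (S.abs_half_center_le v (h.slab i₀ hi₀B)).trans hγb
  have h1' : S.ArchLvInv (fun i => scaledFeldR i.1 H (Sh - (lev + 1))) (S.parityClass v B i₀) (S.halfDiff v i₀) pv
      (fun j => -((v i₀ j - lo j) / 2)) (S.Lb s (lev + 1)) P (wl (lev + 1)) ((γ - S.Lsum (v i₀)) / 2) (cl (lev + 1)) (el (lev + 1))
      {x : ℤ | Odd x ∧ |x| ≤ 2 * (Nh (lev + 1) : ℤ) - 1} (T (lev + 1) 0) := by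
    rw [hwl]; exact h1
  have hQ' : Q (S.parityClass v B i₀) (S.halfDiff v i₀) (lev + 1) := hQhalf lev B v i₀ hi₀B hQ
  have h2 := ArchLvInv.levelRunD hB'U hΛ hγ' (hQV (lev + 1) _ _ hQ') (N (lev + 1)) (T (lev + 1)) (S.n - 1) hO
    (fun ν h0 h1 => hK ν h0 (by omega)) h1'
  rw [show 1 + (S.n - 1) = S.n by omega] at h2
  refine ⟨S.parityClass v B i₀, S.halfDiff v i₀, _, _, hB'U, ?_, hγ', h2, hQ'⟩
  -- injectivity of the new exponents in `λ` (as in `levelUp`)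
  intro i hi i' hi'
  have hiB : i ∈ B := S.parityClass_subset v B i₀ hi
  have hi'B : i' ∈ B := S.parityClass_subset v B i₀ hi'
  have hpar : ∀ j, 2 ∣ v i j - v i₀ j := ((S.mem_parityClass v).mp hi).2
  have hpar' : ∀ j, 2 ∣ v i' j - v i₀ j := ((S.mem_parityClass v).mp hi').2
  rw [← hinj i hiB i' hi'B]
  constructor
  · intro hw
    rw [S.eq_add_two_smul_halfDiff v hpar, S.eq_add_two_smul_halfDiff v hpar', hw]
  · intro hv
    funext j; simp only [halfDiff, hv]

/-- **All the levels over the generic packages**. [cite: Nesterenko2003, §4 Prop. 4.1, p. 80–81] -/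
theorem levelsD {Q : Finset (ℕ × (Fin S.n → ℤ)) → ((ℕ × (Fin S.n → ℤ)) → Fin S.n → ℤ) → ℕ → Prop} {V : ℕ → (Fin S.n → ℤ) → Prop}
    {H Sh : ℕ} {s : Fin S.n → ℕ} {U : Finset (ℕ × (Fin S.n → ℤ))} {pv : ℕ × (Fin S.n → ℤ) → ℤ} {P : ℤ} {δ₀ : ℝ}
    {wl γb : ℕ → ℝ} {cl : ℕ → ℤ} {el : ℕ → Fin S.n → ℤ} (hn : 1 ≤ S.n)
    (hind : ∀ T₁ : Finset (Fin S.n), T₁.Nonempty → ¬ IsSquare (∏ j ∈ T₁, S.α j)) (hΛ : |S.Λ / (S.b S.j₀ : ℝ)| ≤ δ₀)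
    (hQhalf : ∀ (lev : ℕ) (B : Finset (ℕ × (Fin S.n → ℤ))) (v : ℕ × (Fin S.n → ℤ) → Fin S.n → ℤ) (i₀ : ℕ × (Fin S.n → ℤ)),
      i₀ ∈ B → Q B v lev → Q (S.parityClass v B i₀) (S.halfDiff v i₀) (lev + 1))
    (hQV : ∀ lev B v, Q B v lev → ∀ i ∈ B, V lev (v i)) (N T : ℕ → ℕ → ℕ) (Nh : ℕ → ℕ) (hwl : ∀ lev, wl (lev + 1) = wl lev / 2) (hγb : ∀ lev, wl lev / 2 ≤ γb (lev + 1))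
    (hH : ∀ lev < Sh, S.ArchHalfStepHypD (fun i => scaledFeldR i.1 H (Sh - lev)) (fun i => scaledFeldR i.1 H (Sh - (lev + 1))) U (S.Lb s lev) P
      (wl lev) (γb lev) (cl lev) (el lev) (cl (lev + 1)) δ₀ (V lev) (N lev S.n) (Nh (lev + 1)) (T lev S.n) (T (lev + 1) 0))
    (hO : ∀ lev < Sh, S.ArchKStepOddHypD (fun i => scaledFeldR i.1 H (Sh - (lev + 1))) U (S.Lb s (lev + 1)) P (wl (lev + 1)) (γb (lev + 1))
      (cl (lev + 1)) (el (lev + 1)) δ₀ (V (lev + 1)) (Nh (lev + 1)) (N (lev + 1) 1) (T (lev + 1) 0) (T (lev + 1) 1))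
    (hK : ∀ lev < Sh, ∀ ν, 1 ≤ ν → ν < S.n → S.ArchKStepHypD (fun i => scaledFeldR i.1 H (Sh - (lev + 1))) U (S.Lb s (lev + 1)) P
      (wl (lev + 1)) (γb (lev + 1)) (cl (lev + 1)) (el (lev + 1)) δ₀ (V (lev + 1)) (N (lev + 1) ν) (N (lev + 1) (ν + 1)) (T (lev + 1) ν) (T (lev + 1) (ν + 1)))
    (h0 : S.ArchLevelStateQ Q H Sh s U pv P wl γb cl el 0 (N 0 S.n) (T 0 S.n)) :
    ∀ lev ≤ Sh, S.ArchLevelStateQ Q H Sh s U pv P wl γb cl el lev (N lev S.n) (T lev S.n) := by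
  intro lev
  induction lev with
  | zero => intro _; exact h0
  | succ lev ih =>
    intro hle
    exact levelUpD hn hind hΛ hQhalf hQV N T Nh lev (hwl lev) (hγb lev) (hH lev (by omega)) (hO lev (by omega)) (hK lev (by omega))
      (ih (by omega))

/-- **THE LAST-LEVEL STATE OF THE ARCHIMEDEAN FRAME OVER THE GENERIC PACKAGES** (R32 (c1) + R34; the content of `stub_levelsArch` in the
one-stage line): the START state with `Q` at `(0,0)`, all GENERIC record packages (`V lev`-quantified clearing / sizes), the link `hQV`,
independent square classes and `|Λ/b_{j₀}| ≤ δ₀` give, at the last level `Ŝ`, a family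
`B ⊆ U` with exponents injective in `λ`, a centre `|γ| ≤ γb Ŝ`, the Δ-invariant for the weights `Δ(Y₀; ℓ₀, H)` on `|x| ≤ N Ŝ n` to the order
`T Ŝ n`, AND `Q B v Ŝ` — exported BEFORE the `FrameOutputTwo` projection, for an END in other coordinates (ξ = α^{1/N}).
[cite: Nesterenko2003, §4 Prop. 4.1, §4.3 (4.46)–(4.50), p. 80–95] [cite: Yu2013, §5.1; shape only] -/
theorem lastLevelState_of_scheduleD {Q : Finset (ℕ × (Fin S.n → ℤ)) → ((ℕ × (Fin S.n → ℤ)) → Fin S.n → ℤ) → ℕ → Prop} {V : ℕ → (Fin S.n → ℤ) → Prop}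
    {H Sh : ℕ} {s : Fin S.n → ℕ} {U : Finset (ℕ × (Fin S.n → ℤ))} {pv : ℕ × (Fin S.n → ℤ) → ℤ} {P : ℤ} {δ₀ : ℝ}
    {wl γb : ℕ → ℝ} {cl : ℕ → ℤ} {el : ℕ → Fin S.n → ℤ} (hn : 1 ≤ S.n)
    (hind : ∀ T₁ : Finset (Fin S.n), T₁.Nonempty → ¬ IsSquare (∏ j ∈ T₁, S.α j)) (hΛ : |S.Λ / (S.b S.j₀ : ℝ)| ≤ δ₀)
    (hQhalf : ∀ (lev : ℕ) (B : Finset (ℕ × (Fin S.n → ℤ))) (v : ℕ × (Fin S.n → ℤ) → Fin S.n → ℤ) (i₀ : ℕ × (Fin S.n → ℤ)),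
      i₀ ∈ B → Q B v lev → Q (S.parityClass v B i₀) (S.halfDiff v i₀) (lev + 1))
    (hQV : ∀ lev B v, Q B v lev → ∀ i ∈ B, V lev (v i)) (N T : ℕ → ℕ → ℕ) (Nh : ℕ → ℕ) (hwl : ∀ lev, wl (lev + 1) = wl lev / 2) (hγb : ∀ lev, wl lev / 2 ≤ γb (lev + 1))
    (hK0 : ∀ ν, ν < S.n → S.ArchKStepHypD (fun i => scaledFeldR i.1 H (Sh - 0)) U (S.Lb s 0) P (wl 0) (γb 0) (cl 0) (el 0) δ₀ (V 0)
      (N 0 ν) (N 0 (ν + 1)) (T 0 ν) (T 0 (ν + 1)))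
    (hH : ∀ lev < Sh, S.ArchHalfStepHypD (fun i => scaledFeldR i.1 H (Sh - lev)) (fun i => scaledFeldR i.1 H (Sh - (lev + 1))) U (S.Lb s lev) P
      (wl lev) (γb lev) (cl lev) (el lev) (cl (lev + 1)) δ₀ (V lev) (N lev S.n) (Nh (lev + 1)) (T lev S.n) (T (lev + 1) 0))
    (hO : ∀ lev < Sh, S.ArchKStepOddHypD (fun i => scaledFeldR i.1 H (Sh - (lev + 1))) U (S.Lb s (lev + 1)) P (wl (lev + 1)) (γb (lev + 1))
      (cl (lev + 1)) (el (lev + 1)) δ₀ (V (lev + 1)) (Nh (lev + 1)) (N (lev + 1) 1) (T (lev + 1) 0) (T (lev + 1) 1))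
    (hK : ∀ lev < Sh, ∀ ν, 1 ≤ ν → ν < S.n → S.ArchKStepHypD (fun i => scaledFeldR i.1 H (Sh - (lev + 1))) U (S.Lb s (lev + 1)) P
      (wl (lev + 1)) (γb (lev + 1)) (cl (lev + 1)) (el (lev + 1)) δ₀ (V (lev + 1)) (N (lev + 1) ν) (N (lev + 1) (ν + 1)) (T (lev + 1) ν) (T (lev + 1) (ν + 1)))
    (h00 : S.ArchLevelStateQ Q H Sh s U pv P wl γb cl el 0 (N 0 0) (T 0 0)) :
    S.ArchLevelStateQ Q H Sh s U pv P wl γb cl el Sh (N Sh S.n) (T Sh S.n) :=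
  levelsD hn hind hΛ hQhalf hQV N T Nh hwl hγb hH hO hK (levelZeroRunD hΛ hQV N T hK0 h00) Sh le_rfl

end ArchG3Setup

end Summit.ABC.StewartYu

end
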